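import Summits.BirchSwinnertonDyer.BirchSwinnertonDyer.Theorems.ByReductionTypeAtTwoSupersingularThetaHabitat
import Summits.BirchSwinnertonDyer.BirchSwinnertonDyer.Theorems.ThetaPartnerAtTwoSignedMainConjectureCMTwoUnitZone
import Summits.BirchSwinnertonDyer.BirchSwinnertonDyer.Theorems.ThetaPartnerAtTwoSignedMainConjectureCMTwoPeriodUnit
import HarnessLib

/-!
# Route `ByReductionTypeAtTwo` (rung K4), crux `SupersingularRankZeroAtTwo` (item stmt-BirchSwinnertonDyer-19097), THETA
# road: on the UNIT-ZONE theta habitat TP2's crux K2r0 (`SignedMainConjectureCMTwoRankZero`, Pollack–Rubin at the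
# inert prime `2`) is NOT an input — the CM partner's signed main conjecture at `2` follows from Kim's signed
# `Γ`-Euler characteristic at `2` READ FOR THE CM PARTNER (stub (2′) of line `signed_halves_two` with `¬ HasCM`
# replaced by `HasCM`), Burungale–Flach (PUB), Abbes–Ullmo at `2` (PUB) and ONE `2`-adic unit certificate
# (seat `bsd-2adic-ss-1x` GEN 2, WIDTH-LEVER second prover lane on 19097; `--supports 19097 --as helper`)

HONEST FRAMING (cell `bsd-2adic`, run/shared/lean/pub/bsd-2adic/): THEOREMS ONLY — no definition, no named fact,
no `sorry`; every research input is a displayed binder; closes no item; nothing booked; BSD is NOT proved by any of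
this. PARTITION (D-0054): X5@2 good-supersingular, `a₂ = 0`, UNIT-ZONE THETA HABITAT = the habitat curves (non-CM,
`r_an = 0`, good ss at `2`, `a₂ = 0`) admitting a `2`-congruent CM partner `A` (good ss at `2`, `a₂(A) = 0`) with
`ord₂ (L(A,1)/Ω_A) = 0` × `p = 2` — types-the-object-of; bears_on: K4-leaf crux 19097 · TP2 K1 20333 · (K2r0 20312
ELIMINATED on this sub-row) · W-ALL/1.hab.

## What this file proves, and why

GEN 0 (`…SupersingularThetaHabitat.lean`, p528677) showed: 19097 on the theta habitat ⟸ its own stubs (1)(1′)(2′)(4)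
+ TP2's K1 `SignedTransportAtTwo` + K2r0 `SignedMainConjectureCMTwoRankZero` (the CM partner's `μ⁺ = 0` and `+`
main conjecture at `2`, OPEN: Pollack–Rubin's ± decomposition of local units is printed for `p > 2`). Seat
`bsd-wall-tp2-p2` observed (p518019 / `…SignedMainConjectureCMTwoUnitZone.lean`) that for a CM curve `A` in the
UNIT ZONE — `t = L(A,1)/Ω_A` a `2`-adic unit, i.e. `Ш(A)[2] = 0` and `∏ c_ℓ(A)` odd by BSD₂(A) (Burungale–Flach 2024,
PUB) — both conjuncts of K2 at `A` follow from Kobayashi Thm 1.2 + Kim Cor 3.15 READ FOR `A` alone: a generator of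
`char X⁺(A)` has unit constant term, so it is a unit of `Λ`, and `ϖ_A·L⁺_A` is a unit too. This file puts the two
together and replaces K2r0 by per-partner inputs of the SAME KIND as 19097's stub (2′):

* §1 `signedMainConjectureCM_at_of_unitZone_of_signedEulerCharCM` — for a CM `A` good ss at `2` with `a₂ = 0` and a
  certificate `L(A,1)/Ω_A = t`, `t ≠ 0`, `ord₂ t = 0`: Kim's signed `Γ`-Euler characteristic at `2` for CM curves
  (`hECcm` = stub (2′) `stub_zeroSignedEulerChar` with `¬ W.HasCM` replaced by `W.HasCM`, ∀-closed, displayed) +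
  Burungale–Flach + GZK + modularity + Abbes–Ullmo at `2` (`realPeriodRat_eq_unit_mul_plusPeriod_two`, PUB named
  fact, via tp2-p2's `padicValRat_periodRatio_eq_zero_two`) ⟹ (∀ cyclotomic data: `X⁺(A)` torsion ∧ `μ⁺(A) = 0`)
  ∧ `KobayashiMainConjecture A 2 1` — i.e. EXACTLY the two outputs TP2's `closes` takes from K2r0 at `A`. The step
  (2′)^CM ⇒ {Kobayashi 1.2, Kim 3.15 for `A`} is GEN 0's H4 (`exists_constantCoeff_eq_unit_mul_of_signedEulerChar`,
  Greenberg's Lemma 4.2 on the dual pair, any `p`) and the tree theorems `moduleFinite` /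
  `isTorsion_of_finite_endInvariants`.
* §2 `bsdp_two_of_unitZonePartner_of_signedTransport_of_stubs` — **BSD₂ of a habitat curve `W` with a UNIT-ZONE CM
  partner**, binders: PUB (modularity, GZK, Burungale–Flach, Abbes–Ullmo@2), Kato PUB (1′), 19097's stubs (2′) and (4)
  VERBATIM (for `W`), (2′)^CM (for the partner), TP2's K1 by name; arguments `W`, `A`, the unit certificate and the
  equivariant `E[2] ≃ A[2]`. NO K2r0, NO K3/K4 items, NO stub (3)/(4′).
* §3 `thetaHabitatUnitZone_of_signedTransport_of_stubs` — the same ∀-closed: crux 19097 RESTRICTED to the unit-zone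
  theta habitat from {(1)(1′)(2′)(4), (2′)^CM, K1} + PUB.

CENSUS (evidence, NOT used in the proofs; kit j280801 of this seat on item 19097, PARI `ellL1`/`ellbsd`/
`elltamagawa`): of the 19 habitat classes of HABITAT-CENSUS-TP2-v1.1 only **157113h** (partner `27a3`,
`L(A,1)/Ω_A = 1/9`) has a unit-zone partner among the quadratic twists `A₀^D`, `D ≡ 1 (mod 4)` squarefree,
`|D| ≤ 120…400`, of its anchor family: for the twelve other anchor families 0 of the 13–73 rank-`0` twists met per
family is in the unit zone — `∏ c_ℓ(A₀^D)` is EVEN on every rank-`0` twist met for the families of `1089a1`, `225a1`,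
`15129a1`, `31329b1` (`d = 3`) and `121b1`, `361a1`, `1849a1`, `26569a1` (`d = 11, 19, 43, 163`), and `Ш_an` or
`∏ c_ℓ` is even on every rank-`0` twist met for `463347d1`, `9747f1`, `29403e1`, `435483e1`. So K2r0 carries genuine
`λ`-content (`λ⁺(A) ≥ 1`) on 18/19 classes and is eliminable by this file on 1/19 — a quantified statement of where
Pollack–Rubin-at-`2` actually bites on the theta habitat. The per-class display for 157113h is filed separately.

References: [Kobayashi2003] Thm. 1.2, Conjecture p. 2; [BDKim2013] Thm. 1.1, Cor. 3.15; [PollackRubin2004] Thm. 7.3;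
[BurungaleFlach2024] Thm. 1.1; [AbbesUllmo1996] Thm. A; [GreenbergVatsal2000] Thm. (1.4), §3 Rem. 3.4;
[KuriharaOtsuki2006] Rem. 0.2 (3) (`X₀(27)`: the `L♭`-side function is a unit); [GreenbergLNM1716] §4 Lemma 4.2;
[Miller2011LMS] Def. 1.1; GEN 0 files p526623 / p527438 / p528677; tp2-p2 files p518019 / p523402 / `…UnitZone.lean`.
-/

set_option autoImplicit false
-- the Theorems namespace of this sub repeats the summit name by design (D-0017 nested layout)
set_option linter.dupNamespace false

noncomputable section

open scoped Classical MatrixGroups ModularForm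

open CongruenceSubgroup WeierstrassCurve Literature.NumberTheory.EllipticCurves
  Literature.NumberTheory.EllipticCurves.ModularForms Literature.NumberTheory.EllipticCurves.Sprung2017
  Literature.NumberTheory.EllipticCurves.Rank1Residual Literature.NumberTheory.EllipticCurves.Rank1Residual.Typed
  Literature.NumberTheory.EllipticCurves.Kobayashi2003 Literature.NumberTheory.EllipticCurves.IwasawaDual
  ZpExtension Summit.BirchSwinnertonDyer.Rank1Residual Summit.BirchSwinnertonDyer.Rank1Residual.Supersingular
  Summit.BirchSwinnertonDyer.Rank1Residual.X5.O1 Summit.BirchSwinnertonDyer.BirchSwinnertonDyer.Theses.ThetaPartnerAtTwo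

namespace Summit.BirchSwinnertonDyer.BirchSwinnertonDyer.Theorems

namespace ThetaPartnerXRoute

/-! ## §1 K2 AT a unit-zone CM partner from Kim's signed Euler characteristic at `2` read for CM curves -/

/-- A `2`-adic unit certificate `L(A,1)/Ω_A = t`, `t ≠ 0` pins `L(A,1) ≠ 0`. [folklore] -/
theorem entireLFunction_one_ne_zero_of_cert (A : WeierstrassCurve ℚ) [A.IsElliptic]
    {t : ℚ} (ht : A.entireLFunction 1 / (A.realPeriodRat : ℂ) = (t : ℂ)) (ht0 : t ≠ 0) :
    A.entireLFunction 1 ≠ 0 := by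
  intro h0
  rw [h0, zero_div] at ht
  exact ht0 (by exact_mod_cast ht.symm)

/-- **K2 (both conjuncts) AT a unit-zone CM partner, from (2′)^CM.** For a CM curve `A/ℚ`, globally minimal, good
supersingular at `2` with `a₂(A) = 0`, and a certificate `L(A,1)/Ω_A = t ∈ ℚ`, `t ≠ 0`, `ord₂ t = 0`: granted
Burungale–Flach (`hBF`, PUB: BSD for rank-`0` CM curves), modularity (`hmod`), GZK (`hGZK`), Abbes–Ullmo at `2`
(`h2 : realPeriodRat_eq_unit_mul_plusPeriod_two`, PUB named fact) and Kim's signed `Γ`-Euler characteristic at `2`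
for CM curves (`hECcm` — VERBATIM 19097's stub (2′) `stub_zeroSignedEulerChar` with `¬ W.HasCM` replaced by
`W.HasCM`): every cyclotomic dual datum of `Sel⁺(A/ℚ_∞)` is torsion with `μ⁺ = 0`, and Kobayashi's `+` main conjecture
holds for `A` at `2`. Chain: `Sel_{2^∞}(A/ℚ)` finite (GZK, rank `0`) ⇒ `Sel⁺(A/ℚ_∞)^Γ` finite and the EC identity
(`hECcm`) ⇒ `X⁺(A)` f.g. torsion (`moduleFinite`, `isTorsion_of_finite_endInvariants`) and Kim's generator value (H4)
⇒ tp2-p2's `signedMainConjectureCMTwo_pointwise_of_unitZone` with `ord₂ ϖ_A = 0` (`padicValRat_periodRatio_eq_zero_two`)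
and `ord₂ [0]⁺_{f_A} = ord₂ t − ord₂ ϖ_A = 0`. [cite: BDKim2013, Thm. 1.1 and Cor. 3.15 (p. 199)]
[cite: Kobayashi2003, Thm. 1.2 and Conjecture (p. 2)] [cite: BurungaleFlach2024, Thm. 1.1]
[cite: AbbesUllmo1996, Thm. A] [cite: GreenbergLNM1716, §4 Lemma 4.2 (p. 102)] -/
theorem signedMainConjectureCM_at_of_unitZone_of_signedEulerCharCM
    (hBF : bsdTriple_of_hasCM_of_L_one_ne_zero) (hmod : nonempty_modularParametrizationData)
    (hGZK : rank_eq_analyticRank_of_analyticRank_le_one)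
    (h2 : Literature.NumberTheory.EllipticCurves.realPeriodRat_eq_unit_mul_plusPeriod_two)
    (hECcm : ∀ (A : WeierstrassCurve ℚ) [A.IsElliptic] [A.IsGloballyMinimal],
        A.HasCM → A.analyticRank = 0 → GoodSS A 2 → A.frobeniusTrace 2 = 0 →
        ∀ (κ : ZpExtension ℚ 2) (γ : Field.absoluteGaloisGroup ℚ),
          κ.IsCyclotomic → κ.IsTopGenerator γ → Finite (A.selmerGroupPInfty 2) →
          Finite (endInvariants (conjSignedSelmerInfty A κ 1 γ - 1)) ∧
            ∃ u : ℤ_[2]ˣ, (Nat.card (endInvariants (conjSignedSelmerInfty A κ 1 γ - 1)) : ℚ_[2]) =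
              ((u : ℤ_[2]) : ℚ_[2]) * ((2 : ℕ) : ℚ_[2]) ^ (padicValNat 2 A.tamagawaProduct) *
                (Nat.card (A.selmerGroupPInfty 2) : ℚ_[2]) *
                  (Nat.card (EndCoinvariants (conjSignedSelmerInfty A κ 1 γ - 1)) : ℚ_[2]))
    (A : WeierstrassCurve ℚ) [A.IsElliptic] [A.IsGloballyMinimal] (hAcm : A.HasCM) (hAss : GoodSS A 2)
    (hAa : A.frobeniusTrace 2 = 0)
    (hunit : ∃ t : ℚ, A.entireLFunction 1 / (A.realPeriodRat : ℂ) = (t : ℂ) ∧ t ≠ 0 ∧ padicValRat 2 t = 0) :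
    (∀ (κ : ZpExtension ℚ 2) (γ : Field.absoluteGaloisGroup ℚ), κ.IsCyclotomic → κ.IsTopGenerator γ →
      ∀ D : SignedSelmerDualData A κ γ 1, Module.IsTorsion (IwasawaAlgebra 2) D.X ∧ D.mu = 0) ∧
    KobayashiMainConjecture A 2 1 := by
  obtain ⟨t, ht, ht0, ht2⟩ := hunit
  have hLA : A.entireLFunction 1 ≠ 0 := entireLFunction_one_ne_zero_of_cert A ht ht0
  have hAr : A.analyticRank = 0 := analyticRank_eq_zero_of_entireLFunction_one_ne_zero A hLA
  have hSel : Finite (A.selmerGroupPInfty 2) := finite_selmerGroupPInfty_of_analyticRank_eq_zero hGZK A 2 hAr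
  have hΩpos : 0 < A.realPeriodRat := A.realPeriodRat_pos_holds
  refine signedMainConjectureCMTwo_pointwise_of_unitZone A hBF hmod hGZK hAcm hAss hAa hLA ?_ ?_ ?_
  · -- Kobayashi Thm. 1.2 for `A`: f.g. (tree theorem) + torsion (from `S^Γ` finite)
    intro κ γ hκ hγ D
    exact ⟨D.moduleFinite hγ,
      D.isTorsion_of_finite_endInvariants hγ (hECcm A hAcm hAr hAss hAa κ γ hκ hγ hSel).1⟩
  · -- Kim Cor. 3.15 for `A`: the generator value from the Euler characteristic (H4)
    intro κ γ hκ hγ D _ _ g hg hSel'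
    obtain ⟨hfin, u, hu⟩ := hECcm A hAcm hAr hAss hAa κ γ hκ hγ hSel'
    obtain ⟨u', hu'⟩ := exists_constantCoeff_eq_unit_mul_of_signedEulerChar A hγ D hg hfin
      (c := ((2 : ℕ) : ℚ_[2]) ^ (padicValNat 2 A.tamagawaProduct) * (Nat.card (A.selmerGroupPInfty 2) : ℚ_[2]))
      ⟨u, by rw [hu]; ring⟩
    exact ⟨u', by rw [hu', mul_assoc]⟩
  · -- the unit zone: `ord₂ ϖ = 0` (Abbes–Ullmo at `2`) and `ord₂ [0]⁺_f = ord₂ t − ord₂ ϖ = 0`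
    intro _ f hf ϖ hϖ
    have hϖ2 : padicValRat 2 ϖ = 0 := padicValRat_periodRatio_eq_zero_two A h2 hAss hf hϖ
    have hLval : A.entireLFunction 1 = (((ratPlusSymbol f 0 : ℝ) * plusPeriod f : ℝ) : ℂ) :=
      hf.entireLFunction_one_eq
    have hs0 : ratPlusSymbol f 0 ≠ 0 := by
      intro h0
      apply hLA
      rw [hLval, h0]
      simp
    have hϖ0 : ϖ ≠ 0 := by
      rintro rfl
      apply hLA
      have h : plusPeriod f = 0 := by
        have h := hϖ
        simp only [Rat.cast_zero, zero_mul] at h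
        exact h.symm
      rw [hLval, h]
      simp
    have hteq : t = ϖ * ratPlusSymbol f 0 := by
      have h1 : A.entireLFunction 1 / (A.realPeriodRat : ℂ) = ((ϖ * ratPlusSymbol f 0 : ℚ) : ℂ) := by
        rw [hLval, ← hϖ, div_eq_iff (Complex.ofReal_ne_zero.mpr hΩpos.ne')]
        push_cast
        ring
      rw [ht] at h1
      exact_mod_cast h1
    refine ⟨hϖ2, ?_⟩
    have h := ht2
    rw [hteq, padicValRat.mul hϖ0 hs0, hϖ2, zero_add] at h
    exact h

/-! ## §2 BSD₂ of a habitat curve with a UNIT-ZONE CM partner — no K2r0 -/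

/-- **BSD₂ of a theta-habitat curve whose CM partner is in the unit zone**, from 19097's stubs (2′) (4) VERBATIM for
the curve, (2′)^CM for the partner, Kato PUB (1′), TP2's K1 `SignedTransportAtTwo` by name, and PUB (modularity,
GZK, Burungale–Flach, Abbes–Ullmo at `2`); arguments: `W` (non-CM, `r_an = 0`, good ss at `2`, `a₂ = 0`), a CM
curve `A` (good ss at `2`, `a₂(A) = 0`), the unit certificate `L(A,1)/Ω_A = t`, `t ≠ 0`, `ord₂ t = 0`, and a
Galois-equivariant `E[2] ≃ A[2]`. The chain is TP2's `closes` with K2r0 at `A` supplied by §1, K3 by GEN 0's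
`signedKatoDivisibilityUpToAtTwo_of_zeroColemanKato` and K4 by `signedControlAtTwo_of_signedEulerCharAtTwo`.
[cite: GreenbergVatsal2000, Thm. (1.4)] [cite: Kobayashi2003, Thm. 1.2 and Thm. 4.1] [cite: BDKim2013, Cor. 3.15]
[cite: BurungaleFlach2024, Thm. 1.1] [cite: Miller2011LMS, Def. 1.1] -/
theorem bsdp_two_of_unitZonePartner_of_signedTransport_of_stubs
    (hPub : nonempty_modularParametrizationData ∧ rank_eq_analyticRank_of_analyticRank_le_one)
    (hBF : bsdTriple_of_hasCM_of_L_one_ne_zero)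
    (h2 : Literature.NumberTheory.EllipticCurves.realPeriodRat_eq_unit_mul_plusPeriod_two)
    (hKatoPub : Kato2004.thm12_4 ∧ Kato2004_fineSelmerDual_isTorsion)
    (hEC : ∀ (W : WeierstrassCurve ℚ) [W.IsElliptic] [W.IsGloballyMinimal],
        ¬ W.HasCM → W.analyticRank = 0 → GoodSS W 2 → W.frobeniusTrace 2 = 0 →
        ∀ (κ : ZpExtension ℚ 2) (γ : Field.absoluteGaloisGroup ℚ),
          κ.IsCyclotomic → κ.IsTopGenerator γ → Finite (W.selmerGroupPInfty 2) →
          Finite (endInvariants (conjSignedSelmerInfty W κ 1 γ - 1)) ∧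
            ∃ u : ℤ_[2]ˣ, (Nat.card (endInvariants (conjSignedSelmerInfty W κ 1 γ - 1)) : ℚ_[2]) =
              ((u : ℤ_[2]) : ℚ_[2]) * ((2 : ℕ) : ℚ_[2]) ^ (padicValNat 2 W.tamagawaProduct) *
                (Nat.card (W.selmerGroupPInfty 2) : ℚ_[2]) *
                  (Nat.card (EndCoinvariants (conjSignedSelmerInfty W κ 1 γ - 1)) : ℚ_[2]))
    (hCK : ∀ (W : WeierstrassCurve ℚ) [W.IsElliptic] [W.IsGloballyMinimal],
      ¬ W.HasCM → W.analyticRank = 0 → GoodSS W 2 → W.frobeniusTrace 2 = 0 →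
      ∀ (κ : ZpExtension ℚ 2) (γ : Field.absoluteGaloisGroup ℚ),
        κ.IsCyclotomic → κ.IsTopGenerator γ → IsCyclotomicVariable 2 γ →
        ∀ [NeZero (W.conductorNorm ℤ)] (f : CuspForm (Gamma0 (W.conductorNorm ℤ)) 2),
          IsNewformOf W f → ∀ (ϖ : ℚ), (ϖ : ℝ) * W.realPeriodRat = plusPeriod f →
        ∀ (Lplus Lminus : IwasawaAlgebra 2), IsPollackPair f 2 Lplus Lminus →
        ∀ (D : SignedSelmerDualData W κ γ 1) [ContinuousSMul ℤ_[2] (W.tateModule 2)],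
          ∃ (I : Kato2004.IwasawaH1Data W 2 κ γ) (Y : W.FineSelmerDualData κ γ)
            (P : Submodule (IwasawaAlgebra 2) (IwasawaAlgebra 2))
            (loc : I.H →ₗ[IwasawaAlgebra 2] P) (toX : P →ₗ[IwasawaAlgebra 2] D.X)
            (δ : D.X →ₗ[IwasawaAlgebra 2] Y.X) (Z : Submodule (IwasawaAlgebra 2) I.H)
            (G : IwasawaAlgebra 2),
            Function.Exact loc toX ∧ Function.Exact toX δ ∧
            G ∈ Submodule.map (P.subtype ∘ₗ loc) Z ∧
            iwasawaToPowerSeries 2 G =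
              PowerSeries.C (ϖ : ℚ_[2]) * iwasawaToPowerSeries 2 (kobayashiL 1 Lplus Lminus) ∧
            (∀ 𝔭 : PrimeSpectrum (IwasawaAlgebra 2), 𝔭.asIdeal.height = 1 →
              PowerSeries.C (2 : ℤ_[2]) ∉ 𝔭.asIdeal →
              Literature.NumberTheory.EllipticCurves.Module.lengthAt (IwasawaAlgebra 2) Y.X 𝔭 ≤
                Literature.NumberTheory.EllipticCurves.Module.lengthAt (IwasawaAlgebra 2) (I.H ⧸ Z) 𝔭) ∧
            (TwoAdicSurjective W →
              ∀ 𝔭 : PrimeSpectrum (IwasawaAlgebra 2), 𝔭.asIdeal.height = 1 →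
                PowerSeries.C (2 : ℤ_[2]) ∈ 𝔭.asIdeal →
                Literature.NumberTheory.EllipticCurves.Module.lengthAt (IwasawaAlgebra 2) Y.X 𝔭 ≤
                  Literature.NumberTheory.EllipticCurves.Module.lengthAt (IwasawaAlgebra 2) (I.H ⧸ Z) 𝔭))
    (hECcm : ∀ (A : WeierstrassCurve ℚ) [A.IsElliptic] [A.IsGloballyMinimal],
        A.HasCM → A.analyticRank = 0 → GoodSS A 2 → A.frobeniusTrace 2 = 0 →
        ∀ (κ : ZpExtension ℚ 2) (γ : Field.absoluteGaloisGroup ℚ),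
          κ.IsCyclotomic → κ.IsTopGenerator γ → Finite (A.selmerGroupPInfty 2) →
          Finite (endInvariants (conjSignedSelmerInfty A κ 1 γ - 1)) ∧
            ∃ u : ℤ_[2]ˣ, (Nat.card (endInvariants (conjSignedSelmerInfty A κ 1 γ - 1)) : ℚ_[2]) =
              ((u : ℤ_[2]) : ℚ_[2]) * ((2 : ℕ) : ℚ_[2]) ^ (padicValNat 2 A.tamagawaProduct) *
                (Nat.card (A.selmerGroupPInfty 2) : ℚ_[2]) *
                  (Nat.card (EndCoinvariants (conjSignedSelmerInfty A κ 1 γ - 1)) : ℚ_[2]))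
    (hT : SignedTransportAtTwo)
    (W : WeierstrassCurve ℚ) [W.IsElliptic] [W.IsGloballyMinimal] (hcm : ¬ W.HasCM) (hr : W.analyticRank = 0)
    (hss : GoodSS W 2) (ha : W.frobeniusTrace 2 = 0)
    (A : WeierstrassCurve ℚ) [A.IsElliptic] [A.IsGloballyMinimal] (hAcm : A.HasCM)
    (hAss : GoodSS A 2) (hAa : A.frobeniusTrace 2 = 0)
    (hunit : ∃ t : ℚ, A.entireLFunction 1 / (A.realPeriodRat : ℂ) = (t : ℂ) ∧ t ≠ 0 ∧ padicValRat 2 t = 0)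
    (e : WeierstrassCurve.geomTorsion W (2 : ℤ) ≃+ WeierstrassCurve.geomTorsion A (2 : ℤ))
    (he : ∀ (σ : Field.absoluteGaloisGroup ℚ) (P : WeierstrassCurve.geomTorsion W (2 : ℤ)), e (σ • P) = σ • e P) :
    BSDp W 2 := by
  obtain ⟨hmod, hGZK⟩ := hPub
  have hLrat : WeierstrassCurve.hasEntireLFunction_rat :=
    WeierstrassCurve.hasEntireLFunction_rat_of_exists_isNewformOf
      (exists_isNewformOf_of_nonempty_modularParametrizationData hmod)
  have hL : W.entireLFunction 1 ≠ 0 := (W.analyticRank_eq_zero_iff_holds (hLrat W)).mp hr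
  -- the partner's analytic data: `L(A,1) ≠ 0`, newform, period ratio, a Pollack pair at `2`
  obtain ⟨t, ht, ht0, ht2⟩ := hunit
  have hLA : A.entireLFunction 1 ≠ 0 := entireLFunction_one_ne_zero_of_cert A ht ht0
  haveI : NeZero (A.conductorNorm ℤ) := ⟨(A.conductorNorm_pos_holds).ne'⟩
  obtain ⟨DmA⟩ := hmod A
  obtain ⟨ϖA, -, hϖAeq, -⟩ := DmA.exists_rat_mul_realPeriodRat_eq_plusPeriod
  obtain ⟨LsA, LfA, -, hPPA⟩ := exists_isPollackPair_two DmA.isNewformOf hAss.1 hAa hLA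
  -- K2 AT the unit-zone partner (§1), replacing TP2's K2r0
  obtain ⟨hmuA, hMCA⟩ := signedMainConjectureCM_at_of_unitZone_of_signedEulerCharCM hBF hmod hGZK h2 hECcm
    A hAcm hAss hAa ⟨t, ht, ht0, ht2⟩
  -- K3 for `W` from stubs (1′)+(4); K1 transports; K4 for `W` from stub (2′); the `a₂ = 0` door at `2`
  have hKato : SignedKatoDivisibilityUpToAtTwo := signedKatoDivisibilityUpToAtTwo_of_zeroColemanKato hKatoPub hCK
  have hMC : KobayashiMainConjecture W 2 1 :=
    hT W A hcm hr hss ha hAcm hAss hAa ⟨e, he⟩ DmA.f DmA.isNewformOf ϖA hϖAeq LsA LfA hPPA hmuA hMCA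
      (hKato W hcm hr hss ha)
  obtain ⟨h12, hKim⟩ := signedControlAtTwo_of_signedEulerCharAtTwo hEC W hcm hr hss ha
  exact bsdp_two_of_kobayashiMainConjecture_two_of_frobeniusTrace_eq_zero W hmod hGZK hss.1 ha hL h12 hKim hMC

/-! ## §3 ∀-closed: crux 19097 on the UNIT-ZONE theta habitat -/

/-- **Crux 19097 RESTRICTED to the unit-zone theta habitat** — every non-CM `E/ℚ` of analytic rank `0`, good
supersingular at `2` with `a₂ = 0`, that is `2`-congruent to a CM curve `A` good supersingular at `2` with `a₂(A) = 0`
and `ord₂ (L(A,1)/Ω_A) = 0` satisfies BSD₂ — from 19097's stubs (1)(1′)(2′)(4) VERBATIM, (2′)^CM, TP2's K1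
`SignedTransportAtTwo` by name, and PUB (Burungale–Flach, Abbes–Ullmo at `2`). On this sub-row neither the Eisenstein
half (stub (3)), nor `μ⁺ = 0` (stub (4′)), nor TP2's K2r0 (Pollack–Rubin at `2`) occurs.
[cite: GreenbergVatsal2000, Thm. (1.4)] [cite: Kobayashi2003, Thm. 1.2 and Thm. 4.1] [cite: BDKim2013, Cor. 3.15]
[cite: BurungaleFlach2024, Thm. 1.1] [cite: Miller2011LMS, Def. 1.1] -/
theorem thetaHabitatUnitZone_of_signedTransport_of_stubs
    (hPub : nonempty_modularParametrizationData ∧ rank_eq_analyticRank_of_analyticRank_le_one)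
    (hBF : bsdTriple_of_hasCM_of_L_one_ne_zero)
    (h2 : Literature.NumberTheory.EllipticCurves.realPeriodRat_eq_unit_mul_plusPeriod_two)
    (hKatoPub : Kato2004.thm12_4 ∧ Kato2004_fineSelmerDual_isTorsion)
    (hEC : ∀ (W : WeierstrassCurve ℚ) [W.IsElliptic] [W.IsGloballyMinimal],
        ¬ W.HasCM → W.analyticRank = 0 → GoodSS W 2 → W.frobeniusTrace 2 = 0 →
        ∀ (κ : ZpExtension ℚ 2) (γ : Field.absoluteGaloisGroup ℚ),
          κ.IsCyclotomic → κ.IsTopGenerator γ → Finite (W.selmerGroupPInfty 2) →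
          Finite (endInvariants (conjSignedSelmerInfty W κ 1 γ - 1)) ∧
            ∃ u : ℤ_[2]ˣ, (Nat.card (endInvariants (conjSignedSelmerInfty W κ 1 γ - 1)) : ℚ_[2]) =
              ((u : ℤ_[2]) : ℚ_[2]) * ((2 : ℕ) : ℚ_[2]) ^ (padicValNat 2 W.tamagawaProduct) *
                (Nat.card (W.selmerGroupPInfty 2) : ℚ_[2]) *
                  (Nat.card (EndCoinvariants (conjSignedSelmerInfty W κ 1 γ - 1)) : ℚ_[2]))
    (hCK : ∀ (W : WeierstrassCurve ℚ) [W.IsElliptic] [W.IsGloballyMinimal],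
      ¬ W.HasCM → W.analyticRank = 0 → GoodSS W 2 → W.frobeniusTrace 2 = 0 →
      ∀ (κ : ZpExtension ℚ 2) (γ : Field.absoluteGaloisGroup ℚ),
        κ.IsCyclotomic → κ.IsTopGenerator γ → IsCyclotomicVariable 2 γ →
        ∀ [NeZero (W.conductorNorm ℤ)] (f : CuspForm (Gamma0 (W.conductorNorm ℤ)) 2),
          IsNewformOf W f → ∀ (ϖ : ℚ), (ϖ : ℝ) * W.realPeriodRat = plusPeriod f →
        ∀ (Lplus Lminus : IwasawaAlgebra 2), IsPollackPair f 2 Lplus Lminus →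
        ∀ (D : SignedSelmerDualData W κ γ 1) [ContinuousSMul ℤ_[2] (W.tateModule 2)],
          ∃ (I : Kato2004.IwasawaH1Data W 2 κ γ) (Y : W.FineSelmerDualData κ γ)
            (P : Submodule (IwasawaAlgebra 2) (IwasawaAlgebra 2))
            (loc : I.H →ₗ[IwasawaAlgebra 2] P) (toX : P →ₗ[IwasawaAlgebra 2] D.X)
            (δ : D.X →ₗ[IwasawaAlgebra 2] Y.X) (Z : Submodule (IwasawaAlgebra 2) I.H)
            (G : IwasawaAlgebra 2),
            Function.Exact loc toX ∧ Function.Exact toX δ ∧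
            G ∈ Submodule.map (P.subtype ∘ₗ loc) Z ∧
            iwasawaToPowerSeries 2 G =
              PowerSeries.C (ϖ : ℚ_[2]) * iwasawaToPowerSeries 2 (kobayashiL 1 Lplus Lminus) ∧
            (∀ 𝔭 : PrimeSpectrum (IwasawaAlgebra 2), 𝔭.asIdeal.height = 1 →
              PowerSeries.C (2 : ℤ_[2]) ∉ 𝔭.asIdeal →
              Literature.NumberTheory.EllipticCurves.Module.lengthAt (IwasawaAlgebra 2) Y.X 𝔭 ≤
                Literature.NumberTheory.EllipticCurves.Module.lengthAt (IwasawaAlgebra 2) (I.H ⧸ Z) 𝔭) ∧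
            (TwoAdicSurjective W →
              ∀ 𝔭 : PrimeSpectrum (IwasawaAlgebra 2), 𝔭.asIdeal.height = 1 →
                PowerSeries.C (2 : ℤ_[2]) ∈ 𝔭.asIdeal →
                Literature.NumberTheory.EllipticCurves.Module.lengthAt (IwasawaAlgebra 2) Y.X 𝔭 ≤
                  Literature.NumberTheory.EllipticCurves.Module.lengthAt (IwasawaAlgebra 2) (I.H ⧸ Z) 𝔭))
    (hECcm : ∀ (A : WeierstrassCurve ℚ) [A.IsElliptic] [A.IsGloballyMinimal],
        A.HasCM → A.analyticRank = 0 → GoodSS A 2 → A.frobeniusTrace 2 = 0 →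
        ∀ (κ : ZpExtension ℚ 2) (γ : Field.absoluteGaloisGroup ℚ),
          κ.IsCyclotomic → κ.IsTopGenerator γ → Finite (A.selmerGroupPInfty 2) →
          Finite (endInvariants (conjSignedSelmerInfty A κ 1 γ - 1)) ∧
            ∃ u : ℤ_[2]ˣ, (Nat.card (endInvariants (conjSignedSelmerInfty A κ 1 γ - 1)) : ℚ_[2]) =
              ((u : ℤ_[2]) : ℚ_[2]) * ((2 : ℕ) : ℚ_[2]) ^ (padicValNat 2 A.tamagawaProduct) *
                (Nat.card (A.selmerGroupPInfty 2) : ℚ_[2]) *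
                  (Nat.card (EndCoinvariants (conjSignedSelmerInfty A κ 1 γ - 1)) : ℚ_[2]))
    (hT : SignedTransportAtTwo) :
    ∀ (W : WeierstrassCurve ℚ) [W.IsElliptic] [W.IsGloballyMinimal], ¬ W.HasCM → W.analyticRank = 0 →
      GoodSS W 2 → W.frobeniusTrace 2 = 0 →
      (∃ (A : WeierstrassCurve ℚ) (_ : A.IsElliptic) (_ : A.IsGloballyMinimal),
          A.HasCM ∧ GoodSS A 2 ∧ A.frobeniusTrace 2 = 0 ∧
          (∃ t : ℚ, A.entireLFunction 1 / (A.realPeriodRat : ℂ) = (t : ℂ) ∧ t ≠ 0 ∧ padicValRat 2 t = 0) ∧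
          ∃ e : WeierstrassCurve.geomTorsion W (2 : ℤ) ≃+ WeierstrassCurve.geomTorsion A (2 : ℤ),
            ∀ (σ : Field.absoluteGaloisGroup ℚ) (P : WeierstrassCurve.geomTorsion W (2 : ℤ)), e (σ • P) = σ • e P) →
      BSDp W 2 := by
  intro W _ _ hcm hr hss ha hH
  obtain ⟨A, _, _, hAcm, hAss, hAa, hunit, e, he⟩ := hH
  exact bsdp_two_of_unitZonePartner_of_signedTransport_of_stubs hPub hBF h2 hKatoPub hEC hCK hECcm hT W hcm hr hss
    ha A hAcm hAss hAa hunit e he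

/-- **The unit-zone habitat sits inside TP2's habitat**: a unit-zone CM partner is in particular a rank-`0` CM
partner (`L(A,1) ≠ 0`), so TP2's slice leaf `WAllNonCMAtTwoThetaHabitat` covers the unit-zone sub-row outright.
Recorded for the offer legend (the two displays are comparable). [folklore] -/
theorem bsdp_two_of_unitZonePartner_of_thetaHabitat (hHab : Summit.BirchSwinnertonDyer.WAllNonCMAtTwoThetaHabitat)
    (W : WeierstrassCurve ℚ) [W.IsElliptic] [W.IsGloballyMinimal] (hcm : ¬ W.HasCM) (hr : W.analyticRank = 0)
    (hss : GoodSS W 2) (ha : W.frobeniusTrace 2 = 0)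
    (A : WeierstrassCurve ℚ) [A.IsElliptic] [A.IsGloballyMinimal] (hAcm : A.HasCM)
    (hAss : GoodSS A 2) (hAa : A.frobeniusTrace 2 = 0)
    (hunit : ∃ t : ℚ, A.entireLFunction 1 / (A.realPeriodRat : ℂ) = (t : ℂ) ∧ t ≠ 0 ∧ padicValRat 2 t = 0)
    (e : WeierstrassCurve.geomTorsion W (2 : ℤ) ≃+ WeierstrassCurve.geomTorsion A (2 : ℤ))
    (he : ∀ (σ : Field.absoluteGaloisGroup ℚ) (P : WeierstrassCurve.geomTorsion W (2 : ℤ)), e (σ • P) = σ • e P) :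
    BSDp W 2 := by
  obtain ⟨t, ht, ht0, -⟩ := hunit
  have hAr : A.analyticRank = 0 :=
    analyticRank_eq_zero_of_entireLFunction_one_ne_zero A (entireLFunction_one_ne_zero_of_cert A ht ht0)
  exact hHab W hcm hr hss ha ⟨A, ‹_›, ‹_›, hAcm, hAr, hAss, hAa, e, he⟩

end ThetaPartnerXRoute

end Summit.BirchSwinnertonDyer.BirchSwinnertonDyer.Theorems

end
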